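import Literature.NumberTheory.Sieve.HeathBrownCubicETermClasses
import Literature.NumberTheory.Sieve.HeathBrownCubicCubeSumsZero
import HarnessLib

/-!
# Heath-Brown's Lemma 8.1: the class modulo `[J, q]` from the classes modulo `r`, and the case `n = 0`

Layer of the decomposition of **parity.S18**
(`Literature.NumberTheory.Sieve.setOf_prime_cube_add_two_mul_cube_infinite`) along D. R. Heath-Brown,
*Primes represented by `x³ + 2y³`*, Acta Math. 186 (2001), 1–84, companion of `HeathBrownCubicETermClasses`
(the case `n ≥ 1`). In the proof of Lemma 8.1 (p. 50) the sum over `β̂ ∈ 𝒞, J ∣ β, β ≡ α (mod q)` "is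
composed of `r³/N([J, q])` subsums of the form (8.2)", each evaluated by (8.5), and "(8.5) holds for
`n = 0` too". This file PROVES:

* `abs_sum_dvd_class_sub_le_of_classBound` — the passage from the classes modulo `r = N(J ∩ (q))` to
  the class modulo `J ∩ (q)`, ABSTRACTLY: if each residue-class sum `∑_{β̂ ∈ 𝒞, β̂ ≡ γ̂ (mod r)} G(β̂)` is
  within `ℰ` of `r⁻³I₀`, then `|∑_{β̂ ∈ 𝒞, J ∣ β, β ≡ α (mod q)} G(β̂) − [α ∈ J + (q)]·r⁻¹I₀| ≤ r²ℰ` (one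
  class modulo `J ∩ (q)` in the compatible case, made of `r³/N(J ∩ (q)) = r²` classes modulo `r`; an
  empty sum otherwise) — the argument of `abs_sum_dvd_class_wDeriv_sub_le`, separated from (8.5);
* **`abs_sum_dvd_class_wDeriv_sub_le_zero`** — the case `n = 0` (`𝐦` of length one): for a cube as in
  Lemma 3.8 (`CubeCond c₃ c₄ V`, `c₃, c₄, V > 0`), `X ≥ 1`, `τ ≥ 0`, `J ≠ 0`, `q ≥ 1`, `N(J)q³ ≤ S₀`, any `α`,
  `|∑_{β̂ ∈ 𝒞, J ∣ β, β ≡ α (mod q)} w'(N(β)) − [α ∈ J + (q)]·N(J ∩ (q))⁻¹𝓘| ≤ (2808c₃³/c₄ + 108)S₀²`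
  (from `HeathBrown2001_eq_8_5_zero` of `HeathBrownCubicCubeSumsZero`).

## References

* D. R. Heath-Brown, *Primes represented by `x³ + 2y³`*, Acta Math. 186 (2001), 1–84: §8, p. 50.
  [cite: HeathBrownActa2001, §8 p. 50]

## Mathlib / tree search

Tree: `HeathBrownCubicETermClasses` (`sum_filter_sub_mem_eq_sum_classes`, `card_cubeMod_filter_mem_eq_sq`),
`HeathBrownCubicETermRearrangement` (`exists_mem_and_dvd_sub_iff`, `dvd_span_and_dvd_sub_iff`,
`absNorm_inf_span_le`, `inf_span_ne_bot`, `absNorm_span_coordElt_real`), `HeathBrownCubicCubeSumsZero`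
(`HeathBrown2001_eq_8_5_zero`), `HeathBrownCubicCubeSums` (`castVec`, `mem_latticeCube_iff`),
`HeathBrownCubicLatticeCount` (`cubeMod`, `coordElt_surjective`).
-/

noncomputable section

open Polynomial NumberField Finset MeasureTheory

namespace Literature.NumberTheory.Sieve.CubicSieve

open LFunctions.CubeRootTwoField CubicPrimes

section ClassBound

variable {a : ℝ × ℝ × ℝ} {S₀ : ℝ}

open scoped Classical in
/-- **From the classes modulo `r = N([J, q])` to the class modulo `[J, q]`** (p. 50: the sum over
`β̂ ∈ 𝒞, J ∣ β, β ≡ α (mod q)` "is composed of `r³/N([J, q])` subsums of the form (8.2)"), abstractly: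
if every residue-class sum `∑_{β̂ ∈ 𝒞, β̂ ≡ γ̂ (mod r)} G(β̂)` is within `ℰ` of `r⁻³I₀`, then for `J ≠ 0`,
`q ≥ 1`, `r = N(J ∩ (q))`,
`|∑_{β̂ ∈ 𝒞, J ∣ β, β ≡ α (mod q)} G(β̂) − [α ∈ J + (q)]·N(J ∩ (q))⁻¹I₀| ≤ r²ℰ`
(the compatible case is one class `β ≡ β₀ (mod J ∩ (q))`, the union of `r³/N(J ∩ (q)) = r²` classes
modulo `r`; the incompatible case is an empty sum). [cite: HeathBrownActa2001, §8 p. 50] -/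
theorem abs_sum_dvd_class_sub_le_of_classBound {J : Ideal (𝓞 K)} (hJ : J ≠ ⊥) {q : ℕ} (hq : 0 < q)
    (α : 𝓞 K) (G : ℤ × ℤ × ℤ → ℝ) (I₀ : ℝ) {ℰ : ℝ} (hℰ : 0 ≤ ℰ) {r : ℕ}
    (hr : r = Ideal.absNorm (J ⊓ Ideal.span {(q : 𝓞 K)}))
    (hclass : ∀ (γ : ℤ × ℤ × ℤ),
      |∑ v ∈ (latticeCube a S₀).filter
            (fun v => (r : ℤ) ∣ v.1 - γ.1 ∧ (r : ℤ) ∣ v.2.1 - γ.2.1 ∧ (r : ℤ) ∣ v.2.2 - γ.2.2), G v -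
          ((r : ℝ) ^ 3)⁻¹ * I₀| ≤ ℰ) :
    |∑ v ∈ ((latticeCube a S₀).filter (fun v => (q : 𝓞 K) ∣ coordElt v - α)).filter
          (fun v => J ∣ Ideal.span {coordElt v}), G v -
        (if α ∈ J ⊔ Ideal.span {(q : 𝓞 K)} then ((r : ℝ))⁻¹ * I₀ else 0)| ≤ (r : ℝ) ^ 2 * ℰ := by
  set 𝔞 := J ⊓ Ideal.span {(q : 𝓞 K)} with h𝔞
  have h𝔞0 : 𝔞 ≠ ⊥ := inf_span_ne_bot hJ hq
  have hr0 : 0 < r := by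
    rw [hr]; exact Nat.pos_of_ne_zero fun h => h𝔞0 (Ideal.absNorm_eq_zero_iff.mp h)
  have hr𝔞 : ((r : ℤ) : 𝓞 K) ∈ 𝔞 := by rw [Int.cast_natCast, hr]; exact Ideal.absNorm_mem 𝔞
  have hr' : (0 : ℝ) < r := by exact_mod_cast hr0
  by_cases hcompat : α ∈ J ⊔ Ideal.span {(q : 𝓞 K)}
  · rw [if_pos hcompat]
    obtain ⟨β₀, h₀J, h₀q⟩ := (exists_mem_and_dvd_sub_iff J q α).mpr hcompat
    obtain ⟨v₀, hv₀⟩ := coordElt_surjective β₀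
    have hfilter : ((latticeCube a S₀).filter (fun v => (q : 𝓞 K) ∣ coordElt v - α)).filter
        (fun v => J ∣ Ideal.span {coordElt v}) =
        (latticeCube a S₀).filter (fun v => coordElt v - coordElt v₀ ∈ 𝔞) := by
      rw [Finset.filter_filter]
      refine Finset.filter_congr fun v _ => ?_
      rw [and_comm, hv₀]
      exact dvd_span_and_dvd_sub_iff h₀J h₀q _
    rw [hfilter, sum_filter_sub_mem_eq_sum_classes hr0 hr𝔞 v₀]
    set T := (cubeMod r).filter (fun ρ => coordElt ρ ∈ 𝔞) with hT
    have hTcard : (T.card : ℝ) = (r : ℝ) ^ 2 := by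
      rw [hT, hr, card_cubeMod_filter_mem_eq_sq h𝔞0]; push_cast; ring
    have hmain : |∑ ρ ∈ T, ∑ v ∈ (latticeCube a S₀).filter (fun v => (r : ℤ) ∣ v.1 - (v₀ + ρ).1 ∧
            (r : ℤ) ∣ v.2.1 - (v₀ + ρ).2.1 ∧ (r : ℤ) ∣ v.2.2 - (v₀ + ρ).2.2), G v -
          ∑ _ρ ∈ T, (((r : ℝ) ^ 3)⁻¹ * I₀)| ≤ (T.card : ℝ) * ℰ := by
      rw [← Finset.sum_sub_distrib]
      calc _ ≤ ∑ ρ ∈ T, |∑ v ∈ (latticeCube a S₀).filter (fun v => (r : ℤ) ∣ v.1 - (v₀ + ρ).1 ∧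
            (r : ℤ) ∣ v.2.1 - (v₀ + ρ).2.1 ∧ (r : ℤ) ∣ v.2.2 - (v₀ + ρ).2.2), G v - ((r : ℝ) ^ 3)⁻¹ * I₀| :=
            Finset.abs_sum_le_sum_abs _ _
        _ ≤ ∑ _ρ ∈ T, ℰ := Finset.sum_le_sum fun ρ _ => hclass (v₀ + ρ)
        _ = (T.card : ℝ) * ℰ := by rw [Finset.sum_const, nsmul_eq_mul]
    have hTr : ∑ _ρ ∈ T, (((r : ℝ) ^ 3)⁻¹ * I₀) = (r : ℝ)⁻¹ * I₀ := by
      rw [Finset.sum_const, nsmul_eq_mul, hTcard]; field_simp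
    rw [hTr, hTcard] at hmain
    exact hmain
  · rw [if_neg hcompat, sub_zero]
    have hempty : ((latticeCube a S₀).filter (fun v => (q : 𝓞 K) ∣ coordElt v - α)).filter
        (fun v => J ∣ Ideal.span {coordElt v}) = ∅ := by
      rw [Finset.filter_filter, Finset.filter_eq_empty_iff]
      rintro v - ⟨hqv, hJv⟩
      exact hcompat ((exists_mem_and_dvd_sub_iff J q α).mp
        ⟨coordElt v, Ideal.dvd_span_singleton.mp hJv, hqv⟩)
    rw [hempty, Finset.sum_empty, abs_zero]
    positivity

end ClassBound

/-! ### The case `n = 0` -/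

section Zero

variable {X τ : ℝ} {a : ℝ × ℝ × ℝ} {S₀ : ℝ}

open scoped Classical in
/-- **(8.5) summed over the class modulo `[J, q]`, `n = 0`** (pp. 49–50): for a cube as in Lemma 3.8
(`CubeCond c₃ c₄ V`, `c₃, c₄, V > 0`), `𝐦 = (m₁)` of length one, `X ≥ 1`, `τ ≥ 0`, a non-zero ideal `J`
and `q ≥ 1` with `N(J)q³ ≤ S₀`, and any `α`,
`|∑_{β̂ ∈ 𝒞, J ∣ β, β ≡ α (mod q)} w'(N(β)) − [α ∈ J + (q)]·N(J ∩ (q))⁻¹𝓘| ≤ (2808c₃³/c₄ + 108)S₀²`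
("Thus (8.5) holds for `n = 0` too", with `r³/N([J, q]) = r²` subsums each within `(2808c₃³/c₄ + 108)S₀²/r²`
of `r⁻³𝓘`, `HeathBrown2001_eq_8_5_zero`). [cite: HeathBrownActa2001, §8 (8.5)] -/
theorem abs_sum_dvd_class_wDeriv_sub_le_zero (hX : 1 ≤ X) (hτ : 0 ≤ τ) (m : Fin 1 → ℕ)
    {c₃ c₄ V : ℝ} (hc₃ : 0 < c₃) (hc₄ : 0 < c₄) (hV : 0 < V)
    (hcube : CubeCond c₃ c₄ V a S₀) {J : Ideal (𝓞 K)} (hJ : J ≠ ⊥) {q : ℕ} (hq : 0 < q)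
    (hJq : (Ideal.absNorm J : ℝ) * (q : ℝ) ^ 3 ≤ S₀) (α : 𝓞 K) :
    |∑ v ∈ ((latticeCube a S₀).filter (fun v => (q : 𝓞 K) ∣ coordElt v - α)).filter
          (fun v => J ∣ Ideal.span {coordElt v}),
          wDeriv X τ m (Ideal.absNorm (Ideal.span {coordElt v})) -
        (if α ∈ J ⊔ Ideal.span {(q : 𝓞 K)} then
          ((Ideal.absNorm (J ⊓ Ideal.span {(q : 𝓞 K)}) : ℝ))⁻¹ * cubeIntegral X τ m a S₀ else 0)| ≤
      (2808 * (c₃ ^ 3 / c₄) + 108) * S₀ ^ 2 := by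
  set 𝔞 := J ⊓ Ideal.span {(q : 𝓞 K)} with h𝔞
  set r := Ideal.absNorm 𝔞 with hr
  have h𝔞0 : 𝔞 ≠ ⊥ := inf_span_ne_bot hJ hq
  have hr0 : 0 < r := Nat.pos_of_ne_zero fun h => h𝔞0 (Ideal.absNorm_eq_zero_iff.mp h)
  have hr' : (0 : ℝ) < r := by exact_mod_cast hr0
  have hrS : (r : ℝ) ≤ S₀ := by
    have h1 : (r : ℝ) ≤ (Ideal.absNorm J : ℝ) * (q : ℝ) ^ 3 := by exact_mod_cast absNorm_inf_span_le hJ hq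
    exact h1.trans hJq
  have hK : 0 ≤ 2808 * (c₃ ^ 3 / c₄) + 108 := by positivity
  -- the summand in the form of (8.5)
  have hsummand : ∀ v ∈ latticeCube a S₀,
      wDeriv X τ m (Ideal.absNorm (Ideal.span {coordElt v})) = wDeriv X τ m (normForm (castVec v)) := by
    intro v hv
    have hvC : castVec v ∈ realCube a S₀ := mem_latticeCube_iff.mp hv
    have hN : c₄ * V ≤ normForm (castVec v) := (hcube _ hvC).2.2.2
    have hNpos : 0 < normForm (castVec v) := lt_of_lt_of_le (mul_pos hc₄ hV) hN
    rw [absNorm_span_coordElt_real, abs_of_pos]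
    · rfl
    · exact hNpos
  have hsum_eq : ∑ v ∈ ((latticeCube a S₀).filter (fun v => (q : 𝓞 K) ∣ coordElt v - α)).filter
        (fun v => J ∣ Ideal.span {coordElt v}), wDeriv X τ m (Ideal.absNorm (Ideal.span {coordElt v})) =
      ∑ v ∈ ((latticeCube a S₀).filter (fun v => (q : 𝓞 K) ∣ coordElt v - α)).filter
        (fun v => J ∣ Ideal.span {coordElt v}), wDeriv X τ m (normForm (castVec v)) :=
    Finset.sum_congr rfl fun v hv =>
      hsummand v (Finset.mem_filter.mp (Finset.mem_filter.mp hv).1).1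
  rw [hsum_eq]
  have hclass : ∀ (γ : ℤ × ℤ × ℤ),
      |∑ v ∈ (latticeCube a S₀).filter (fun v => (r : ℤ) ∣ v.1 - γ.1 ∧ (r : ℤ) ∣ v.2.1 - γ.2.1 ∧
          (r : ℤ) ∣ v.2.2 - γ.2.2), wDeriv X τ m (normForm (castVec v)) -
        ((r : ℝ) ^ 3)⁻¹ * cubeIntegral X τ m a S₀| ≤ (2808 * (c₃ ^ 3 / c₄) + 108) * (S₀ ^ 2 / r ^ 2) :=
    fun γ => HeathBrown2001_eq_8_5_zero hX hτ m hc₃ hc₄ hV hcube hr0 hrS γ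
  have h := abs_sum_dvd_class_sub_le_of_classBound (a := a) (S₀ := S₀) hJ hq α
    (fun v => wDeriv X τ m (normForm (castVec v))) (cubeIntegral X τ m a S₀) (by positivity) hr hclass
  refine h.trans (le_of_eq ?_)
  field_simp

end Zero

end Literature.NumberTheory.Sieve.CubicSieve

end
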